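import Mathlib
import HarnessLib

/-!
# Compact groups: two-sided invariance of Haar measure and Weyl's unitarian trick

Generic facts about a compact topological group `G` (not necessarily Hausdorff, not necessarily
second countable) that are used by the reflection-positivity proof for Wilson's lattice gauge
theory (`Literature.MathematicalPhysics.QuantumFieldTheory.ConstructiveQFTWave0Proofs`):

* `Literature.RepresentationTheory.CompactGroups.CompactGroup.isMulRightInvariant_of_isHaarMeasure` — a (left) Haar measure on a compact
  group is right invariant (compact groups are unimodular);
* `Literature.RepresentationTheory.CompactGroups.CompactGroup.isInvInvariant_of_isHaarMeasure` — it is invariant under `g ↦ g⁻¹`;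
* `Literature.RepresentationTheory.CompactGroups.CompactGroup.exists_isUnit_conj_mem_unitaryGroup` — **Weyl's unitarian trick**
  (finite-dimensional case; Bröcker–tom Dieck II.(1.7), (1.6)): every continuous matrix
  representation `ρ : G →* Matrix n n ℂ` of a compact group is conjugate to a unitary one,
  `B ρ B⁻¹ ∈ U(n)`;
  the averaged Gram matrix `P = ∫ ρ(k)ᴴ ρ(k) dk` is positive definite and `ρ`-invariant, and
  `P = Bᴴ B`;
* consequences for characters: `trace (ρ g⁻¹) = conj (trace (ρ g))`,
  `|trace (ρ g)| ≤ n`-type entry bounds for the unitarised representation, and the Gram form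
  `Re tr ρ(g h⁻¹) = Re ∑ₐ₍b₎ σ(g)_{ab} conj σ(h)_{ab}` (`σ = unitarize ρ`), which exhibits
  `(g, h) ↦ Re tr ρ(g h⁻¹)` as a positive-semidefinite kernel.

All statements are proved (no named facts).

References: A. Weil, *L'intégration dans les groupes topologiques* (1940) §§7–8 (unimodularity of
compact groups); H. Weyl, *The classical groups* (1939) Ch. VIII §B; T. Bröcker, T. tom Dieck,
*Representations of compact Lie groups* (1985), II.1.7 (invariant inner products by averaging).
-/

open MeasureTheory MeasureTheory.Measure TopologicalSpace Filter Complex Matrix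
open scoped ComplexOrder MatrixOrder ENNReal NNReal

namespace Literature.RepresentationTheory.CompactGroups.CompactGroup

noncomputable section

variable {G : Type*} [Group G] [TopologicalSpace G] [IsTopologicalGroup G] [CompactSpace G]

/-! ## Haar measure on a compact group is two-sided invariant -/

/-- A compact topological group is locally compact (as needed by the Haar-measure API).
[folklore] -/
theorem locallyCompactSpace_of_compactSpace_group : LocallyCompactSpace G :=
  (⊤ : PositiveCompacts G).locallyCompactSpace_of_group

section Haar

variable [MeasurableSpace G] [BorelSpace G]

/-- **Compact groups are unimodular**: a Haar measure on a compact group is right invariant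
(Bröcker–tom Dieck I.(5.12): `∫ f(g) dg = ∫ f(hg) dg = ∫ f(gh) dg = ∫ f(g⁻¹) dg`, stated there for
compact Lie groups with the remark that it holds for compact topological groups; proved here in
that generality). Proof: `map (· * g) μ = Δ(g) • μ` with `Δ` the modular function; comparing total
masses (finite and non-zero) gives `Δ(g) = 1`. [cite: BrockerTomDieck1985, I.(5.12)] -/
theorem isMulRightInvariant_of_isHaarMeasure (μ : Measure G) [IsHaarMeasure μ] :
    IsMulRightInvariant μ := by
  haveI : LocallyCompactSpace G := locallyCompactSpace_of_compactSpace_group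
  refine ⟨fun g => ?_⟩
  have h := map_right_mul_eq_modularCharacterFun_smul μ g
  have hC : (modularCharacterFun g : ℝ≥0∞) = 1 := by
    have h1 : (modularCharacterFun g : ℝ≥0∞) * μ Set.univ = 1 * μ Set.univ := by
      rw [one_mul, ← smul_eq_mul, ← ENNReal.smul_def, ← Measure.smul_apply, ← h,
        map_apply (measurable_mul_const g) MeasurableSet.univ, Set.preimage_univ]
    exact (ENNReal.mul_left_inj (isOpen_univ.measure_ne_zero μ Set.univ_nonempty)
      (measure_ne_top _ _)).1 h1
  rw [ENNReal.coe_eq_one] at hC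
  rw [h, hC, one_smul]

/-- A Haar measure on a compact group is invariant under inversion `g ↦ g⁻¹`
(Bröcker–tom Dieck I.(5.12), `∫ f(g) dg = ∫ f(g⁻¹) dg`). Proof: `μ.inv` is again left invariant
(by right invariance of `μ`), hence `μ.inv = c • μ`; total masses agree, so `c = 1`.
[cite: BrockerTomDieck1985, I.(5.12)] -/
theorem isInvInvariant_of_isHaarMeasure (μ : Measure G) [IsHaarMeasure μ] :
    IsInvInvariant μ := by
  haveI : LocallyCompactSpace G := locallyCompactSpace_of_compactSpace_group
  haveI : IsMulRightInvariant μ := isMulRightInvariant_of_isHaarMeasure μ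
  refine ⟨?_⟩
  set C : ℝ≥0 := haarScalarFactor μ.inv μ
  have hC : μ.inv = C • μ := isMulLeftInvariant_eq_smul_of_innerRegular _ _
  suffices C = 1 by rw [hC, this, one_smul]
  have h1 : (C : ℝ≥0∞) * μ Set.univ = 1 * μ Set.univ := by
    rw [one_mul, ← smul_eq_mul, ← ENNReal.smul_def, ← Measure.smul_apply, ← hC, Measure.inv_apply,
      Set.inv_univ]
  rwa [ENNReal.mul_left_inj (isOpen_univ.measure_ne_zero μ Set.univ_nonempty)
    (measure_ne_top _ _), ENNReal.coe_eq_one] at h1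

/-- The normalised Haar measure `haarMeasure ⊤` of a compact group is a probability measure.
[folklore] -/
theorem isProbabilityMeasure_haarMeasure_top :
    IsProbabilityMeasure (haarMeasure (⊤ : PositiveCompacts G)) :=
  ⟨by simpa using (haarMeasure_self (G := G) (K₀ := ⊤))⟩

/-- Right translation invariance of integrals against a Haar measure on a compact group.
[folklore] -/
theorem integral_mul_right_eq_self_of_isHaarMeasure (μ : Measure G) [IsHaarMeasure μ]
    {E : Type*} [NormedAddCommGroup E] [NormedSpace ℝ E] (f : G → E) (g : G) :
    ∫ k, f (k * g) ∂μ = ∫ k, f k ∂μ := by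
  haveI : IsMulRightInvariant μ := isMulRightInvariant_of_isHaarMeasure μ
  exact integral_mul_right_eq_self f g

end Haar

/-! ## Weyl's unitarian trick (finite-dimensional matrix representations) -/

section UnitaryTrick

variable {n : Type*} [Fintype n]

omit [Group G] [IsTopologicalGroup G] [CompactSpace G] [Fintype n] in
/-- Entries of a continuous matrix-valued map are continuous. [folklore] -/
theorem continuous_entry {ρ : G → Matrix n n ℂ} (hρ : Continuous ρ) (a b : n) :
    Continuous fun k => ρ k a b :=
  hρ.matrix_elem a b

omit [Group G] [IsTopologicalGroup G] [CompactSpace G] in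
/-- Entries of `k ↦ ρ(k)ᴴ ρ(k)` are continuous. [folklore] -/
theorem continuous_conjTranspose_mul_self_entry {ρ : G → Matrix n n ℂ} (hρ : Continuous ρ)
    (c e : n) : Continuous fun k => ((ρ k)ᴴ * ρ k) c e :=
  ((hρ.matrix_conjTranspose).matrix_mul hρ).matrix_elem c e

/-- Expansion of a two-sided matrix product entry. [folklore] -/
theorem conj_mul_apply (A M B : Matrix n n ℂ) (a b : n) :
    (A * M * B) a b = ∑ e, ∑ c, A a c * M c e * B e b := by
  simp only [Matrix.mul_apply, Finset.sum_mul]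

section Gram

variable [MeasurableSpace G] [BorelSpace G]

omit [Group G] [IsTopologicalGroup G] in
/-- Continuous functions on a compact group are integrable for a measure finite on compacts.
[folklore] -/
theorem integrable_of_continuous {E : Type*} [NormedAddCommGroup E] {μ : Measure G}
    [IsFiniteMeasureOnCompacts μ] {f : G → E} (hf : Continuous f) : Integrable f μ :=
  hf.integrable_of_hasCompactSupport (HasCompactSupport.of_compactSpace f)

/-- The averaged Gram matrix `P = ∫ ρ(k)ᴴ ρ(k) dμ(k)` of a matrix-valued map (entrywise Bochner
integrals). [folklore] -/
def gramAverage (μ : Measure G) (ρ : G → Matrix n n ℂ) : Matrix n n ℂ :=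
  Matrix.of fun a b => ∫ k, ((ρ k)ᴴ * ρ k) a b ∂μ

omit [Group G] [TopologicalSpace G] [IsTopologicalGroup G] [CompactSpace G] [BorelSpace G] in
/-- Entries of the Gram average. [folklore] -/
theorem gramAverage_apply (μ : Measure G) (ρ : G → Matrix n n ℂ) (a b : n) :
    gramAverage μ ρ a b = ∫ k, ∑ c, (starRingEnd ℂ) (ρ k c a) * ρ k c b ∂μ := by
  simp [gramAverage, Matrix.mul_apply, Matrix.conjTranspose_apply]

variable (μ : Measure G) [IsHaarMeasure μ] [DecidableEq n] (ρ : G →* Matrix n n ℂ)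

omit [TopologicalSpace G] [IsTopologicalGroup G] [CompactSpace G] [BorelSpace G] [IsHaarMeasure μ] in
/-- The Gram average is Hermitian. [folklore] -/
theorem gramAverage_isHermitian : (gramAverage μ ρ).IsHermitian := by
  ext a b
  simp only [Matrix.conjTranspose_apply, gramAverage_apply, Complex.star_def, ← integral_conj,
    _root_.map_sum, map_mul, Complex.conj_conj]
  refine integral_congr_ae (ae_of_all _ fun k => Finset.sum_congr rfl fun c _ => ?_)
  ring

/-- Invariance of the Gram average: `ρ(g)ᴴ P ρ(g) = P` (right invariance of Haar measure on the
compact group). [folklore] -/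
theorem conjTranspose_mul_gramAverage_mul (hρ : Continuous ρ) (g : G) :
    (ρ g)ᴴ * gramAverage μ ρ * ρ g = gramAverage μ ρ := by
  haveI : IsMulRightInvariant μ := isMulRightInvariant_of_isHaarMeasure μ
  ext a b
  set M : G → Matrix n n ℂ := fun k => (ρ k)ᴴ * ρ k with hM
  have hint : ∀ c e : n, Integrable (fun k => M k c e) μ :=
    fun c e => integrable_of_continuous (continuous_conjTranspose_mul_self_entry hρ c e)
  calc ((ρ g)ᴴ * gramAverage μ ρ * ρ g) a b
      = ∑ e, ∑ c, (ρ g)ᴴ a c * (∫ k, M k c e ∂μ) * ρ g e b := by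
        rw [conj_mul_apply]; rfl
    _ = ∫ k, ∑ e, ∑ c, (ρ g)ᴴ a c * M k c e * ρ g e b ∂μ := by
        rw [integral_finsetSum _ fun e _ => ?_]
        · refine Finset.sum_congr rfl fun e _ => ?_
          rw [integral_finsetSum _ fun c _ => ?_]
          · refine Finset.sum_congr rfl fun c _ => ?_
            rw [integral_mul_const, integral_const_mul]
          · exact ((hint c e).const_mul _).mul_const _
        · exact integrable_finsetSum _ fun c _ => ((hint c e).const_mul _).mul_const _
    _ = ∫ k, ((ρ g)ᴴ * M k * ρ g) a b ∂μ := by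
        simp only [conj_mul_apply]
    _ = ∫ k, M (k * g) a b ∂μ := by
        refine integral_congr_ae (ae_of_all _ fun k => ?_)
        simp only [hM, map_mul, Matrix.conjTranspose_mul, Matrix.mul_assoc]
    _ = ∫ k, M k a b ∂μ := integral_mul_right_eq_self (fun k => M k a b) g
    _ = gramAverage μ ρ a b := rfl

omit [IsTopologicalGroup G] in
/-- The quadratic form of the Gram average: `xᴴ P x = ∫ ‖ρ(k) x‖² dμ(k)`. [folklore] -/
theorem star_dotProduct_gramAverage_mulVec (hρ : Continuous ρ) (x : n → ℂ) :
    star x ⬝ᵥ (gramAverage μ ρ *ᵥ x) =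
      ((∫ k, ∑ c, Complex.normSq ((ρ k *ᵥ x) c) ∂μ : ℝ) : ℂ) := by
  set M : G → Matrix n n ℂ := fun k => (ρ k)ᴴ * ρ k with hM
  have hint : ∀ c e : n, Integrable (fun k => M k c e) μ :=
    fun c e => integrable_of_continuous (continuous_conjTranspose_mul_self_entry hρ c e)
  rw [← integral_complex_ofReal]
  calc star x ⬝ᵥ (gramAverage μ ρ *ᵥ x)
      = ∑ a, star (x a) * ∑ b, (∫ k, M k a b ∂μ) * x b := by
        simp only [dotProduct, Matrix.mulVec, Pi.star_apply]; rfl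
    _ = ∫ k, ∑ a, star (x a) * ∑ b, M k a b * x b ∂μ := by
        rw [integral_finsetSum _ fun a _ => ?_]
        · refine Finset.sum_congr rfl fun a _ => ?_
          rw [integral_const_mul, integral_finsetSum _ fun b _ => ?_]
          · refine congrArg _ (Finset.sum_congr rfl fun b _ => ?_)
            rw [integral_mul_const]
          · exact (hint a b).mul_const _
        · exact (integrable_finsetSum _ fun b _ => (hint a b).mul_const _).const_mul _
    _ = ∫ k, star x ⬝ᵥ (M k *ᵥ x) ∂μ := by
        simp only [dotProduct, Matrix.mulVec, Pi.star_apply]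
    _ = ∫ k, ((∑ c, Complex.normSq ((ρ k *ᵥ x) c) : ℝ) : ℂ) ∂μ := by
        refine integral_congr_ae (ae_of_all _ fun k => ?_)
        rw [hM]
        dsimp only
        rw [← Matrix.mulVec_mulVec, Matrix.dotProduct_mulVec, ← Matrix.star_mulVec]
        simp only [dotProduct, Pi.star_apply, Complex.star_def, Complex.ofReal_sum,
          Complex.normSq_eq_conj_mul_self]

omit [IsTopologicalGroup G] in
/-- The Gram average of a continuous representation of a compact group is positive definite.
[folklore] -/
theorem gramAverage_posDef (hρ : Continuous ρ) : (gramAverage μ ρ).PosDef := by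
  refine Matrix.PosDef.of_dotProduct_mulVec_pos (gramAverage_isHermitian μ ρ) fun x hx => ?_
  rw [star_dotProduct_gramAverage_mulVec μ ρ hρ x, Complex.zero_lt_real]
  set f : G → ℝ := fun k => ∑ c, Complex.normSq ((ρ k *ᵥ x) c) with hf
  have hfc : Continuous f := continuous_finsetSum _ fun c _ =>
    Complex.continuous_normSq.comp ((continuous_apply c).comp (hρ.matrix_mulVec continuous_const))
  have hf0 : 0 ≤ f := fun k => Finset.sum_nonneg fun c _ => Complex.normSq_nonneg _
  rw [integral_pos_iff_support_of_nonneg hf0 (integrable_of_continuous hfc)]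
  refine hfc.isOpen_support.measure_pos μ ⟨1, ?_⟩
  rw [Function.mem_support]
  have : f 1 = ∑ c, Complex.normSq (x c) := by simp [hf]
  rw [this]
  obtain ⟨c, hc⟩ : ∃ c, x c ≠ 0 := by
    by_contra! h
    exact hx (funext h)
  exact (Finset.sum_pos' (fun i _ => Complex.normSq_nonneg _)
    ⟨c, Finset.mem_univ _, Complex.normSq_pos.2 hc⟩).ne'

end Gram

variable [DecidableEq n] (ρ : G →* Matrix n n ℂ)

/-- **Weyl's unitarian trick** (Bröcker–tom Dieck II.(1.7) Theorem: a representation of a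
compact group possesses an invariant inner product, `c(u, v) = ∫ b(gu, gv) dg`; with II.(1.6): in an
orthonormal basis the matrix representation takes values in `U(n)`). A continuous
finite-dimensional matrix representation of a compact group is conjugate to a unitary
representation: there is an invertible `B` with `B ρ(g) B⁻¹ ∈ U(n)` for all `g`. (`P = Bᴴ B` is the
`ρ`-invariant averaged Gram matrix for the normalised Haar measure on the Borel σ-algebra.)
[cite: BrockerTomDieck1985, II.(1.7) and (1.6)] -/
theorem exists_isUnit_conj_mem_unitaryGroup (hρ : Continuous ρ) :
    ∃ B : Matrix n n ℂ, IsUnit B ∧ ∀ g, B * ρ g * B⁻¹ ∈ Matrix.unitaryGroup n ℂ := by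
  borelize G
  set μ : Measure G := haarMeasure ⊤
  have hP := gramAverage_posDef μ ρ hρ
  obtain ⟨B, hB⟩ := CStarAlgebra.nonneg_iff_eq_star_mul_self.mp hP.posSemidef.nonneg
  have hdetP : (gramAverage μ ρ).det ≠ 0 := hP.det_pos.ne'
  have hBdet : IsUnit B.det := by
    rw [isUnit_iff_ne_zero]
    intro h0
    apply hdetP
    rw [hB, Matrix.det_mul, Matrix.star_eq_conjTranspose, Matrix.det_conjTranspose, h0, mul_zero]
  have hBunit : IsUnit B := (Matrix.isUnit_iff_isUnit_det B).2 hBdet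
  refine ⟨B, hBunit, fun g => ?_⟩
  rw [Matrix.mem_unitaryGroup_iff']
  have hinv := conjTranspose_mul_gramAverage_mul μ ρ hρ g
  rw [hB, Matrix.star_eq_conjTranspose] at hinv
  calc star (B * ρ g * B⁻¹) * (B * ρ g * B⁻¹)
      = (B⁻¹)ᴴ * ((ρ g)ᴴ * (Bᴴ * B) * ρ g) * B⁻¹ := by
        simp only [Matrix.star_eq_conjTranspose, Matrix.conjTranspose_mul, Matrix.mul_assoc]
    _ = (B * B⁻¹)ᴴ * (B * B⁻¹) := by
        rw [hinv]; simp only [Matrix.conjTranspose_mul, Matrix.mul_assoc]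
    _ = 1 := by rw [Matrix.mul_nonsing_inv B hBdet]; simp

/-! ### The unitarised representation and its character -/

omit [TopologicalSpace G] [IsTopologicalGroup G] [CompactSpace G] in
/-- Conjugating a matrix representation by an invertible matrix gives a representation.
[folklore] -/
theorem conj_mul_conj (B : Matrix n n ℂ) (hB : IsUnit B.det) (g h : G) :
    B * ρ g * B⁻¹ * (B * ρ h * B⁻¹) = B * ρ (g * h) * B⁻¹ := by
  rw [map_mul]
  calc B * ρ g * B⁻¹ * (B * ρ h * B⁻¹) = B * ρ g * (B⁻¹ * B) * ρ h * B⁻¹ := by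
        simp only [Matrix.mul_assoc]
    _ = B * (ρ g * ρ h) * B⁻¹ := by rw [Matrix.nonsing_inv_mul B hB]; simp only [Matrix.mul_one,
        Matrix.mul_assoc]

/-- The representation `g ↦ B ρ(g) B⁻¹` conjugate to `ρ` by an invertible matrix `B`.
[folklore] -/
def conjRep (B : Matrix n n ℂ) (hB : IsUnit B.det) : G →* Matrix n n ℂ where
  toFun g := B * ρ g * B⁻¹
  map_one' := by simp [Matrix.mul_nonsing_inv B hB]
  map_mul' g h := (conj_mul_conj ρ B hB g h).symm

omit [TopologicalSpace G] [IsTopologicalGroup G] [CompactSpace G] in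
/-- Unfolding `conjRep`. [folklore] -/
@[simp] theorem conjRep_apply (B : Matrix n n ℂ) (hB : IsUnit B.det) (g : G) :
    conjRep ρ B hB g = B * ρ g * B⁻¹ := rfl

/-- A matrix `B` unitarising the continuous representation `ρ` of the compact group `G`
(a choice, from `exists_isUnit_conj_mem_unitaryGroup`). [folklore] -/
def unitarizer (hρ : Continuous ρ) : Matrix n n ℂ :=
  Classical.choose (exists_isUnit_conj_mem_unitaryGroup ρ hρ)

/-- The unitariser is invertible. [folklore] -/
theorem isUnit_unitarizer (hρ : Continuous ρ) : IsUnit (unitarizer ρ hρ) :=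
  (Classical.choose_spec (exists_isUnit_conj_mem_unitaryGroup ρ hρ)).1

/-- The unitariser has invertible determinant. [folklore] -/
theorem isUnit_det_unitarizer (hρ : Continuous ρ) : IsUnit (unitarizer ρ hρ).det :=
  (Matrix.isUnit_iff_isUnit_det _).1 (isUnit_unitarizer ρ hρ)

/-- **The unitarised representation** `σ = B ρ B⁻¹` of a continuous matrix representation `ρ`
of a compact group: a continuous homomorphism into the unitary group with the same character.
[folklore] -/
def unitarize (hρ : Continuous ρ) : G →* Matrix n n ℂ :=
  conjRep ρ (unitarizer ρ hρ) (isUnit_det_unitarizer ρ hρ)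

/-- Unfolding `unitarize`. [folklore] -/
theorem unitarize_apply (hρ : Continuous ρ) (g : G) :
    unitarize ρ hρ g = unitarizer ρ hρ * ρ g * (unitarizer ρ hρ)⁻¹ := rfl

/-- `σ(g)` is unitary. [folklore] -/
theorem unitarize_mem_unitaryGroup (hρ : Continuous ρ) (g : G) :
    unitarize ρ hρ g ∈ Matrix.unitaryGroup n ℂ :=
  (Classical.choose_spec (exists_isUnit_conj_mem_unitaryGroup ρ hρ)).2 g

/-- `σ(g)ᴴ σ(g) = 1`. [folklore] -/
theorem star_unitarize_mul_self (hρ : Continuous ρ) (g : G) :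
    star (unitarize ρ hρ g) * unitarize ρ hρ g = 1 :=
  Matrix.mem_unitaryGroup_iff'.1 (unitarize_mem_unitaryGroup ρ hρ g)

/-- `σ(g) σ(g)ᴴ = 1`. [folklore] -/
theorem unitarize_mul_star_self (hρ : Continuous ρ) (g : G) :
    unitarize ρ hρ g * star (unitarize ρ hρ g) = 1 :=
  Matrix.mem_unitaryGroup_iff.1 (unitarize_mem_unitaryGroup ρ hρ g)

/-- `σ` is continuous. [folklore] -/
theorem continuous_unitarize (hρ : Continuous ρ) : Continuous (unitarize ρ hρ) := by
  change Continuous fun g => unitarizer ρ hρ * ρ g * (unitarizer ρ hρ)⁻¹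
  exact (continuous_const.matrix_mul hρ).matrix_mul continuous_const

/-- `σ` has the same character as `ρ`. [folklore] -/
theorem trace_unitarize (hρ : Continuous ρ) (g : G) :
    (unitarize ρ hρ g).trace = (ρ g).trace := by
  rw [unitarize_apply, Matrix.trace_mul_cycle, Matrix.nonsing_inv_mul _ (isUnit_det_unitarizer ρ hρ),
    Matrix.one_mul]

/-- `σ(g⁻¹) = σ(g)ᴴ`. [folklore] -/
theorem unitarize_inv (hρ : Continuous ρ) (g : G) :
    unitarize ρ hρ g⁻¹ = star (unitarize ρ hρ g) := by
  have h1 : unitarize ρ hρ g⁻¹ * unitarize ρ hρ g = 1 := by rw [← map_mul, inv_mul_cancel, map_one]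
  calc unitarize ρ hρ g⁻¹
      = unitarize ρ hρ g⁻¹ * (unitarize ρ hρ g * star (unitarize ρ hρ g)) := by
        rw [unitarize_mul_star_self, Matrix.mul_one]
    _ = star (unitarize ρ hρ g) := by rw [← Matrix.mul_assoc, h1, Matrix.one_mul]

/-- **Characters of compact groups**: `tr ρ(g⁻¹) = conj (tr ρ(g))` for a continuous
finite-dimensional representation of a compact group. [folklore] -/
theorem trace_map_inv (hρ : Continuous ρ) (g : G) :
    (ρ g⁻¹).trace = (starRingEnd ℂ) (ρ g).trace := by
  rw [← trace_unitarize ρ hρ, ← trace_unitarize ρ hρ, unitarize_inv, Matrix.star_eq_conjTranspose,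
    Matrix.trace_conjTranspose, Complex.star_def]

/-- `Re tr ρ(g⁻¹) = Re tr ρ(g)` for a continuous finite-dimensional representation of a
compact group. [folklore] -/
theorem re_trace_map_inv (hρ : Continuous ρ) (g : G) :
    ((ρ g⁻¹).trace).re = ((ρ g).trace).re := by
  rw [trace_map_inv ρ hρ, Complex.conj_re]

omit [TopologicalSpace G] [IsTopologicalGroup G] [CompactSpace G] in
/-- The character is a class function (no compactness needed). [folklore] -/
theorem trace_conj_eq (g h : G) : (ρ (h * g * h⁻¹)).trace = (ρ g).trace := by
  rw [map_mul, map_mul, Matrix.trace_mul_cycle, ← map_mul, inv_mul_cancel, map_one, Matrix.one_mul]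

/-- **Gram form of the character kernel**: `Re tr ρ(g h⁻¹) = ∑_{a,b} Re (σ(g)_{ab} conj σ(h)_{ab})`,
exhibiting `(g, h) ↦ Re tr ρ(g h⁻¹)` as a positive-semidefinite (Gram) kernel. [folklore] -/
theorem re_trace_mul_inv_eq_sum (hρ : Continuous ρ) (g h : G) :
    ((ρ (g * h⁻¹)).trace).re =
      ∑ a, ∑ b, (unitarize ρ hρ g a b * (starRingEnd ℂ) (unitarize ρ hρ h a b)).re := by
  rw [← trace_unitarize ρ hρ, map_mul, unitarize_inv, Matrix.star_eq_conjTranspose, Matrix.trace]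
  simp only [Matrix.diag_apply, Matrix.mul_apply, Matrix.conjTranspose_apply, Complex.star_def,
    Complex.re_sum]

/-- Entries of the unitarised representation are bounded by `1`. [folklore] -/
theorem norm_unitarize_apply_le_one (hρ : Continuous ρ) (g : G) (a b : n) :
    ‖unitarize ρ hρ g a b‖ ≤ 1 :=
  entry_norm_bound_of_unitary (unitarize_mem_unitaryGroup ρ hρ g) a b

/-- `|Re tr ρ(g)| ≤ n` for a continuous `n`-dimensional representation of a compact group.
[folklore] -/
theorem abs_re_trace_le_card (hρ : Continuous ρ) (g : G) :
    |((ρ g).trace).re| ≤ Fintype.card n := by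
  rw [← trace_unitarize ρ hρ, Matrix.trace]
  simp only [Matrix.diag_apply, Complex.re_sum]
  calc |∑ a, (unitarize ρ hρ g a a).re| ≤ ∑ a, |(unitarize ρ hρ g a a).re| :=
        Finset.abs_sum_le_sum_abs _ _
    _ ≤ ∑ _a : n, (1 : ℝ) := Finset.sum_le_sum fun a _ =>
        (Complex.abs_re_le_norm _).trans (norm_unitarize_apply_le_one ρ hρ g a a)
    _ = Fintype.card n := by simp

end UnitaryTrick

end

end Literature.RepresentationTheory.CompactGroups.CompactGroup
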